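import Literature.NumberTheory.EllipticCurves.IwasawaTwistModPShapiroConj
import Literature.NumberTheory.EllipticCurves.Kato2004.IntegralH1Corestriction
import HarnessLib

/-!
# K6 crux `MuTransferX9` (stmt-BirchSwinnertonDyer-19276), skeleton v6 stub `stub_stepsTwoFourOdd`,
# input «G3a»: the RELATIVE inverse Shapiro map inside an open subgroup `N ≤ Γ_K`
# (`cor_{N ∩ Γ_n}^{N} ∘ H¹(m ↦ m·T⁰)`), its compatibility with the absolute one
# (`cor_N^{Γ_K} ∘ Sh_N⁻¹ = Sh⁻¹ ∘ cor_{N ∩ Γ_n}^{Γ_n}`), and the transport of Kato's integral classes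
# `integralH1` along coefficient maps and along relative corestrictions `cor_{V → U}` with `U ∩ I_𝔓 ≤ V`

Cell `bsd-smallim`, seat `bsd-smallim-koly` (gen 9).  THEOREMS ONLY (no definition, no named fact, no
`sorry`).  HONEST FRAMING: helper toward the open stub `stub_stepsTwoFourOdd` of the registered
skeleton v6 (sha16 `a90a661b046bb403`) of the crux `MuTransferX9`; this file closes nothing.  It is
the first of the three «G3a» files (the GENUINE tame class `y = 𝐳̄_q` on `Gal(ℚ̄/ℚ(μ_q))` from
`Kato2004.IsEulerSystemClass` — the input `y`, `hyI`, `h𝒩` of k6-g3's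
`KolyvaginTwist.exists_kolyvaginCocycle_meetingPoint`, p458422): the generic cohomological plumbing.

## What

For a field `K`, a `ℤ_p`-extension `κ` (`Γ_n = κ.layerSubgroup n`), a discrete `Γ_K`-module `ρ` on
`M` killed by `p` (`𝒯_{p^n} = κ.twistModP ρ hM (p^n)`) and ANY subgroup `N ≤ Γ_K`:

* `cohomologyMap_resLe` — `H¹` of an `H'`-equivariant coefficient map commutes with restriction to
  `H ≤ H'` (generic `TopRep`, two lines on cocycles; companion of k6-ty's `cohomologyMap_coresLe`).
* **`cores_coresLe_cohomologyMap_unitCoeff`** — the RELATIVE inverse Shapiro map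
  `Sh_N⁻¹ := cor_{N ⊓ Γ_n}^{N} ∘ H¹(unitCoeff) : H¹(N ∩ Γ_n, M) → H¹(N, 𝒯_{p^n})` (k6-ty's formula
  `coresShapiro n = cor_{Γ_n}^{Γ_K} ∘ H¹(m ↦ m T⁰)`, `IwasawaTwistModPShapiroCores`, run INSIDE `N`;
  written inline, no new definition) satisfies
  `cor_N^{Γ_K} (Sh_N⁻¹ c) = coresShapiro n (cor_{N ⊓ Γ_n}^{Γ_n} c)` — FORMAL: both sides are
  `cor_{N ⊓ Γ_n}^{Γ_K} (H¹(unitCoeff) c)` by the transitivity of the transfer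
  (`cores_coresLe_eq_cores`) and its naturality in the coefficients (`cohomologyMap_coresLe`).  No
  surjectivity / Shapiro bijectivity for `N` is claimed or needed: the Euler-system norm relation is
  an identity between corestrictions, and this lemma moves it from `H¹(ℚ_n, E[p])` to
  `H¹(ℚ, 𝒯_{p^n})` along `cor_N^{Γ_ℚ}` — exactly the `h𝒩`/norm-witness currency of Lemma 2
  (`KolyvaginTwist.exists_kolyvaginCocycle_rat`).
* Over `ℚ` (Kato's `integralH1 T p U` = classes vanishing on `U ∩ I_𝔓` for all `𝔓 ∣ v ≠ p`):
  `cohomologyMap_mem_integralH1` (coefficient maps preserve integrality) and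
  **`coresLe_mem_integralH1_of_inertia_le`** — `cor_{V → U}` preserves integrality as soon as
  `U ∩ I_𝔓 ≤ V` for every `𝔓 ∣ v ≠ p` (the tree's `Kato2004.coresLe_mem_integralH1`, bsd-potss, asks
  instead that `V` be unramified at every `v ≠ p`, which FAILS for Kato's tame level
  `V = Gal(ℚ̄/ℚ(μ_{p^k}, μ_q))` at `v = q`; the proof is the same transfer computation and is adapted
  from that file: for `g ∈ U ∩ I_𝔓 ⊆ V`, `g` acts trivially on `U/V` and
  `(cor_s φ)(g) = Σ_x s(x)·φ(s(x)⁻¹ g s(x))` with `s(x)⁻¹ g s(x) ∈ V ∩ I_{s(x)⁻¹𝔓}`); corollary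
  `coresLe_mem_integralH1_inf` for `V = N ⊓ Γ`, `U = N` when `Γ` is unramified away from `p`.

References: J.-P. Serre, *Galois Cohomology* (1997) I §2.4–2.5 [SerreGaloisCohomology1997];
J. Neukirch, A. Schmidt, K. Wingberg, *Cohomology of Number Fields* (2008) I §5, (1.5.7), (1.6.4)
[NeukirchSchmidtWingberg2008]; K. Kato, Astérisque 295 (2004) §8.2, Lemma 8.5, §13.8
[Kato2004Asterisque]; HOME/koly/MU-TRANSFER-PROOF.md §3 (INPUT of Lemma 2).
-/

-- the summit and its single problem are both named `BirchSwinnertonDyer` (registry layout D-0017)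
set_option linter.dupNamespace false
set_option autoImplicit false

noncomputable section

open CategoryTheory Function Finset
open scoped NumberField Pointwise
open Field IsDedekindDomain
open Literature.NumberTheory.GaloisRepresentations
open Literature.NumberTheory.EllipticCurves
open Literature.NumberTheory.EllipticCurves.ZpExtension
open Literature.NumberTheory.EllipticCurves.Kato2004
open Rat.HeightOneSpectrum

universe u w

namespace Summit.BirchSwinnertonDyer.BirchSwinnertonDyer.Rank1Residual.TameClass

/-! ## §1 `H¹` of a coefficient map commutes with restriction -/

section Naturality

variable {k : Type w} [CommRing k] [TopologicalSpace k]
variable {G : Type u} [Group G] [TopologicalSpace G] [IsTopologicalGroup G]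
variable {X Y : TopRep.{u} k G} {H H' : Subgroup G}

/-- **`H¹` of an `H'`-equivariant coefficient map commutes with restriction** to `H ≤ H'`:
`H¹(f|_H) (res c) = res (H¹(f) c)` — on cocycles both sides are `f ∘ φ|_H`.
[cite: SerreGaloisCohomology1997, I §2.4] -/
theorem cohomologyMap_resLe (h : H ≤ H') (f : subgroupRep X H' ⟶ subgroupRep Y H')
    (c : continuousCohomology 1 (subgroupRep X H')) :
    cohomologyMap (restrictHomOfLe h f) 1 (resLe X h 1 c) = resLe Y h 1 (cohomologyMap f 1 c) := by
  obtain ⟨φ, rfl⟩ := oneCocycleClass_surjective _ c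
  rw [resLe_oneCocycleClass, cohomologyMap_oneCocycleClass, cohomologyMap_oneCocycleClass,
    resLe_oneCocycleClass]
  exact congrArg _ (Subtype.ext (ContinuousMap.ext fun _ => rfl))

end Naturality

/-! ## §2 The relative inverse Shapiro map inside `N` and its compatibility with `cor_N^{Γ_K}` -/

section RelativeShapiro

variable {K : Type u} [Field K] {p : ℕ} [Fact p.Prime] (κ : ZpExtension K p)
variable {M : Type u} [AddCommGroup M] [TopologicalSpace M] [DiscreteTopology M]
variable (ρ : DiscreteGaloisModule K M) (hM : ∀ m : M, p • m = 0) (n : ℕ)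
variable (N : Subgroup (absoluteGaloisGroup K))

/-- `N ∩ Γ_n` is open when `N` is. [cite: SerreGaloisCohomology1997, I §2.4] -/
theorem isOpen_inf_layerSubgroup (hN : IsOpen (N : Set (absoluteGaloisGroup K))) :
    IsOpen ((N ⊓ κ.layerSubgroup n : Subgroup (absoluteGaloisGroup K)) :
      Set (absoluteGaloisGroup K)) :=
  hN.inter (κ.isOpen_layerSubgroup n)

/-- **`cor_N^{Γ_K} ∘ Sh_N⁻¹ = Sh⁻¹ ∘ cor_{N ∩ Γ_n}^{Γ_n}`.**  For the relative inverse Shapiro map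
`Sh_N⁻¹ c := cor_{N ⊓ Γ_n}^{N} (H¹(unitCoeff) c)` (`c ∈ H¹(N ∩ Γ_n, M)`, values in
`H¹(N, 𝒯_{p^n})`) one has `cor_N^{Γ_K} (Sh_N⁻¹ c) = coresShapiro n (cor_{N ⊓ Γ_n}^{Γ_n} c)` in
`H¹(K, 𝒯_{p^n})`: both sides equal `cor_{N ⊓ Γ_n}^{Γ_K} (H¹(m ↦ m T⁰) c)` (transitivity of the transfer,
naturality of `cor` in the coefficients).  Serre: "`π` donne la corestriction
`H^q(H, A) = H^q(G, M_G^H(A)) → H^q(G, A)`". [cite: SerreGaloisCohomology1997, I §2.5 Prop. 10 and (b)]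
[cite: NeukirchSchmidtWingberg2008, (1.6.4)–(1.6.5) and Prop. 1.5.3] -/
theorem cores_coresLe_cohomologyMap_unitCoeff (hN : IsOpen (N : Set (absoluteGaloisGroup K)))
    (hNn : IsOpen ((N ⊓ κ.layerSubgroup n : Subgroup (absoluteGaloisGroup K)) :
      Set (absoluteGaloisGroup K)))
    [Fintype (absoluteGaloisGroup K ⧸ N)] [Fintype (absoluteGaloisGroup K ⧸ κ.layerSubgroup n)]
    [Fintype (absoluteGaloisGroup K ⧸ (N ⊓ κ.layerSubgroup n))]
    [Fintype (N ⧸ (N ⊓ κ.layerSubgroup n).subgroupOf N)]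
    [Fintype (κ.layerSubgroup n ⧸ (N ⊓ κ.layerSubgroup n).subgroupOf (κ.layerSubgroup n))]
    (c : continuousCohomology 1 (subgroupRep ρ.toTopRep (N ⊓ κ.layerSubgroup n))) :
    cores (κ.twistModP ρ hM (p ^ n)).toTopRep N hN
        (coresLe (κ.twistModP ρ hM (p ^ n)).toTopRep
          (inf_le_left : N ⊓ κ.layerSubgroup n ≤ N) hNn
          (cohomologyMap (restrictHomOfLe (inf_le_right : N ⊓ κ.layerSubgroup n ≤ κ.layerSubgroup n)
            (κ.unitCoeffHom ρ hM n)) 1 c)) =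
      κ.coresShapiro ρ hM n
        (coresLe ρ.toTopRep (inf_le_right : N ⊓ κ.layerSubgroup n ≤ κ.layerSubgroup n) hNn c) := by
  rw [cores_coresLe_eq_cores]
  change _ = cores _ (κ.layerSubgroup n) (κ.isOpen_layerSubgroup n)
    (cohomologyMap (κ.unitCoeffHom ρ hM n) 1 (coresLe ρ.toTopRep _ hNn c))
  rw [cohomologyMap_coresLe, cores_coresLe_eq_cores]

end RelativeShapiro

/-! ## §3 Integral classes along coefficient maps and relative corestrictions (over `ℚ`) -/

section Integral

variable {A : Type} [CommRing A] [TopologicalSpace A]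
variable {M : Type} [AddCommGroup M] [Module A M] [TopologicalSpace M] [IsTopologicalAddGroup M]
  [ContinuousSMul A M]
variable {M' : Type} [AddCommGroup M'] [Module A M'] [TopologicalSpace M'] [IsTopologicalAddGroup M']
  [ContinuousSMul A M']

/-- **Coefficient maps preserve Kato's integral classes**: for a `U`-equivariant continuous linear
`f : T|_U → T'|_U`, `H¹(f)` maps `integralH1 T p U` into `integralH1 T' p U` (`H¹(f)` commutes with
the restrictions to `U ∩ I_𝔓`). [cite: Kato2004Asterisque, §8.2 and Lemma 8.5 (pp. 180–184)] -/
theorem cohomologyMap_mem_integralH1 (T : GaloisRep ℚ A M) (T' : GaloisRep ℚ A M') (p : ℕ)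
    {U : Subgroup (absoluteGaloisGroup ℚ)}
    (f : subgroupRep T.toTopRep U ⟶ subgroupRep T'.toTopRep U)
    {x : H1 T U} (hx : x ∈ integralH1 T p U) :
    cohomologyMap f 1 x ∈ integralH1 T' p U := by
  rw [mem_integralH1_iff] at hx ⊢
  intro v hv 𝔓 h𝔓
  rw [← cohomologyMap_resLe, hx v hv 𝔓 h𝔓, map_zero]

/-- For `V` normal, elements of `V` act trivially on `U/V` (copy of the private lemma of
`Kato2004/IntegralH1Corestriction`). [cite: NeukirchSchmidtWingberg2008, I §5 (1.5.7)] -/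
private theorem smul_eq_self_of_mem' {G : Type*} [Group G] {N U : Subgroup G} [N.Normal] {n : U}
    (hn : (n : G) ∈ N) (x : U ⧸ N.subgroupOf U) : n • x = x := by
  induction x using QuotientGroup.induction_on with
  | H u =>
    rw [MulAction.Quotient.smul_mk, QuotientGroup.eq, Subgroup.mem_subgroupOf, smul_eq_mul]
    have : (((n * u)⁻¹ * u : U) : G) = (u : G)⁻¹ * (n : G)⁻¹ * ((u : G)⁻¹)⁻¹ := by
      push_cast; group
    rw [this]
    exact Subgroup.Normal.conj_mem inferInstance _ (N.inv_mem hn) _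

open Literature.NumberTheory.EllipticCurves (schreierElt schreierElt_mem schreierElt_coe
  rep_mul_schreierElt subgroupInclusion subgroupInclusion_apply_coe) in
/-- **Relative corestriction preserves the integral classes whenever `U ∩ I_𝔓 ≤ V`.**  Let `V ⊴ Γ_ℚ`
be normal, open, of finite index in `U ≥ V`, and assume that for every rational prime `v ≠ p` and
every `𝔓 ∣ v` the elements of `U` lying in `I_𝔓` already lie in `V`.  Then `cor_{V → U}` maps
`integralH1 T p V` into `integralH1 T p U`: for `g ∈ U ∩ I_𝔓 ⊆ V`, `g` acts trivially on `U/V`, so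
`(cor_s φ)(g) = Σ_x s(x)·φ(s(x)⁻¹ g s(x))` with `s(x)⁻¹ g s(x) ∈ V ∩ I_{s(x)⁻¹𝔓}`, where `φ` is a
coboundary — whence `cor_s φ` is a coboundary on `U ∩ I_𝔓` with witness `Σ_x s(x)·w_x`.  (The tree's
`Kato2004.coresLe_mem_integralH1` is the case "`V` unramified at every `v ≠ p`"; Kato's tame levels
`Gal(ℚ̄/ℚ(μ_{p^k}, μ_q))` are ramified at `q`, but satisfy the present hypothesis inside
`U = Gal(ℚ̄/ℚ_n(μ_q))`.)  Adapted from `Literature/…/Kato2004/IntegralH1Corestriction.lean`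
(bsd-potss). [cite: Kato2004Asterisque, §8.2 and Lemma 8.5 (pp. 180–184)]
[cite: NeukirchSchmidtWingberg2008, I §5 (1.5.7)] -/
theorem coresLe_mem_integralH1_of_inertia_le (T : GaloisRep ℚ A M) (p : ℕ)
    {V U : Subgroup (absoluteGaloisGroup ℚ)} [V.Normal] (h : V ≤ U)
    (hV : IsOpen (V : Set (absoluteGaloisGroup ℚ))) [Fintype (U ⧸ V.subgroupOf U)]
    (hunr : ∀ v : HeightOneSpectrum (𝓞 ℚ), ((primesEquiv v : Nat.Primes) : ℕ) ≠ p →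
      ∀ 𝔓 ∈ v.primesAbove, ∀ g ∈ U, g ∈ 𝔓.inertia (absoluteGaloisGroup ℚ) → g ∈ V)
    {x : H1 T V} (hx : x ∈ integralH1 T p V) :
    coresLe T.toTopRep h hV x ∈ integralH1 T p U := by
  rw [mem_integralH1_iff] at hx ⊢
  intro v hv 𝔓 h𝔓
  obtain ⟨φ, rfl⟩ := oneCocycleClass_surjective _ x
  -- representatives of `U/V`
  have hs : ∀ y : U ⧸ V.subgroupOf U, ((Quotient.out y : U) : U ⧸ V.subgroupOf U) = y :=
    fun y ↦ QuotientGroup.out_eq' y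
  -- `φ` is a coboundary on `V ∩ I_{𝔓'}` for every `𝔓' ∣ v`: choose the witnesses at the conjugates
  have hcob : ∀ y : U ⧸ V.subgroupOf U, ∃ w : M,
      ∀ g : ↥(V ⊓ ((((Quotient.out y : U) : absoluteGaloisGroup ℚ)⁻¹ • 𝔓).inertia
        (absoluteGaloisGroup ℚ))),
      φ.1 (subgroupInclusion inf_le_left g) = T.toTopRep.ρ (g : absoluteGaloisGroup ℚ) w - w := by
    intro y
    have h0 := hx v hv _ (smul_mem_primesAbove h𝔓 ((Quotient.out y : U) : absoluteGaloisGroup ℚ)⁻¹)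
    rw [resLe_oneCocycleClass, oneCocycleClass_eq_zero_iff] at h0
    obtain ⟨w, hw⟩ := h0
    exact ⟨w, fun g ↦ hw g⟩
  choose w hw using hcob
  rw [coresLe_oneCocycleClass T.toTopRep h hV hs φ, resLe_oneCocycleClass, oneCocycleClass_eq_zero_iff]
  refine ⟨∑ y, T.toTopRep.ρ ((Quotient.out y : U) : absoluteGaloisGroup ℚ) (w y), fun g ↦ ?_⟩
  -- `g ∈ U ∩ I_𝔓`, hence `g ∈ V` and it acts trivially on `U/V`
  have hgI : (g : absoluteGaloisGroup ℚ) ∈ 𝔓.inertia (absoluteGaloisGroup ℚ) := g.2.2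
  have hgV : (g : absoluteGaloisGroup ℚ) ∈ V := hunr v hv 𝔓 h𝔓 _ g.2.1 hgI
  rw [contOneCocycles.pullback_apply, TopRep.hom_ofHom]
  change (transferCocycle (subgroupRep T.toTopRep U) (V.subgroupOf U) (isOpen_subgroupOf U hV) hs
      (contOneCocycles.pullback (subgroupOfHom h)
        (Y := subgroupRep (subgroupRep T.toTopRep U) (V.subgroupOf U))
        (TopRep.ofHom ⟨ContinuousLinearMap.id A M, fun _ => rfl⟩) φ)).1
      (subgroupInclusion (inf_le_left : U ⊓ 𝔓.inertia (absoluteGaloisGroup ℚ) ≤ U) g) = _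
  rw [transferCocycle_pullback_apply T.toTopRep h hV hs, map_sum, ← Finset.sum_sub_distrib]
  refine Finset.sum_congr rfl fun y _ ↦ ?_
  have hgy : subgroupInclusion (inf_le_left : U ⊓ 𝔓.inertia (absoluteGaloisGroup ℚ) ≤ U) g • y = y :=
    smul_eq_self_of_mem' (by simpa [subgroupInclusion_apply_coe] using hgV) y
  -- the Schreier element `s(y)⁻¹ g s(y)` lies in `V ∩ I_{s(y)⁻¹ 𝔓}`
  set σ : absoluteGaloisGroup ℚ := ((Quotient.out y : U) : absoluteGaloisGroup ℚ) with hσ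
  have hmemI : σ⁻¹ * (g : absoluteGaloisGroup ℚ) * σ ∈ (σ⁻¹ • 𝔓).inertia (absoluteGaloisGroup ℚ) := by
    have := (Ideal.conj_mem_inertia_smul_iff 𝔓 σ⁻¹ (g : absoluteGaloisGroup ℚ)).mpr hgI
    simpa using this
  have hmemV : σ⁻¹ * (g : absoluteGaloisGroup ℚ) * σ ∈ V :=
    Subgroup.Normal.conj_mem' inferInstance _ hgV σ
  have key := hw y ⟨σ⁻¹ * (g : absoluteGaloisGroup ℚ) * σ, hmemV, hmemI⟩
  have harg : subgroupOfHom h (schreierElt (V.subgroupOf U) hs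
        (subgroupInclusion (inf_le_left : U ⊓ 𝔓.inertia (absoluteGaloisGroup ℚ) ≤ U) g) y) =
      subgroupInclusion inf_le_left ⟨σ⁻¹ * (g : absoluteGaloisGroup ℚ) * σ, hmemV, hmemI⟩ := by
    apply Subtype.ext
    rw [subgroupOfHom_apply_coe, schreierElt_coe, hgy, subgroupInclusion_apply_coe]
    simp [hσ, subgroupInclusion_apply_coe]
  have key' : φ.1 (subgroupInclusion inf_le_left ⟨σ⁻¹ * (g : absoluteGaloisGroup ℚ) * σ, hmemV, hmemI⟩) =
      T.toTopRep.ρ (σ⁻¹ * (g : absoluteGaloisGroup ℚ) * σ) (w y) - w y := key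
  rw [hgy, harg, key', map_sub, subgroupRep_ρ_apply, ← ρ_mul_apply, ← ρ_mul_apply, ← hσ]
  have hprod : σ * (σ⁻¹ * (g : absoluteGaloisGroup ℚ) * σ) = (g : absoluteGaloisGroup ℚ) * σ := by
    group
  rw [hprod]

/-- **`cor_{N ∩ Γ → N}` preserves integrality when `Γ ⊴ Γ_ℚ` is unramified away from `p`**
(every `I_𝔓`, `𝔓 ∣ v ≠ p`, lies in `Γ`; e.g. `Γ = κ.layerSubgroup n` for the cyclotomic
`ℤ_p`-extension, `ZpExtension.inertia_le_kerSubgroup_holds`): the instance `V = N ⊓ Γ`, `U = N` of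
`coresLe_mem_integralH1_of_inertia_le`. [cite: Kato2004Asterisque, §8.2 and Lemma 8.5 (pp. 180–184)] -/
theorem coresLe_mem_integralH1_inf (T : GaloisRep ℚ A M) (p : ℕ)
    {N Γ : Subgroup (absoluteGaloisGroup ℚ)} [N.Normal] [Γ.Normal]
    (hNΓ : IsOpen ((N ⊓ Γ : Subgroup (absoluteGaloisGroup ℚ)) : Set (absoluteGaloisGroup ℚ)))
    [Fintype (N ⧸ (N ⊓ Γ).subgroupOf N)]
    (hΓ : ∀ v : HeightOneSpectrum (𝓞 ℚ), ((primesEquiv v : Nat.Primes) : ℕ) ≠ p →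
      ∀ 𝔓 ∈ v.primesAbove, 𝔓.inertia (absoluteGaloisGroup ℚ) ≤ Γ)
    {x : H1 T (N ⊓ Γ)} (hx : x ∈ integralH1 T p (N ⊓ Γ)) :
    coresLe T.toTopRep (inf_le_left : N ⊓ Γ ≤ N) hNΓ x ∈ integralH1 T p N :=
  coresLe_mem_integralH1_of_inertia_le T p inf_le_left hNΓ
    (fun v hv 𝔓 h𝔓 _ hgN hgI ↦ ⟨hgN, hΓ v hv 𝔓 h𝔓 hgI⟩) hx

end Integral

end Summit.BirchSwinnertonDyer.BirchSwinnertonDyer.Rank1Residual.TameClass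

end
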